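import Literature.MathematicalPhysics.QuantumFieldTheory.O2NeutralSectorsCells
import HarnessLib

/-!
# O(2) `{φ, s, t}` scan: neutral-sector term matrices on BOXES and at the APEX (rules (M), (T))

[cite: ChesterEtAl2020, §3.1 (functional conditions), App. «Crossing vectors»]
[cite: HogervorstRychkov2013, §3 eqs. (3.6), (3.9)] [cite: KosPolandSimmonsduffin2014, §3.3 eq. (3.16), §4]
[cite: Hladik2017, Thm. 1]

WHAT THIS FILE DOES (engines lane SDP-4, O(2) client path; Lean side only).  The cell rules of
`O2NeutralSectorsHead` / `…Cells` leave, per cell, the family of hypotheses "every `0⁺` (`0⁻`) term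
matrix `M(E, j)` off the head set is PSD for `E` in a window", and the HEAVY range `Δ ≥ E₀` is the same
statement for all terms.  Here the term matrices get the two finite rules of the `σ–ε` verifier:
* §1 every entry of `M^{0±}(E, j)` is a TWO-WEIGHT EVALUATION
  `Σ_m (c_m v_m^s 𝒫_{E,j}(z_m, z̄_m) − d_m u_m^s 𝒫_{E,j}(1−z_m, 1−z̄_m))` of `𝒫_{E,j}` with explicit
  direct / reflected weight vectors `c = cw… i k`, `d = dw… i k` (linear in the 22 weight rows) and
  the label exponent `s = D.expo (lab… i k)` (`termMatrix0p_apply_eq_twoWeightEval`,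
  `termMatrix0m_apply_eq_twoWeightEval`);
* §2 RULE (M) on a box `E ∈ [E₁, E₂]` (fixed `j`, fixed external dimensions): the corner numbers
  `cornerBound₂(c, d) ≤ M_ik ≤ −cornerBound₂(−c, −d)` enclose every entry, so the four sign–radius vertex
  matrices of `(boxLo0p, boxRad0p)` PSD ⇒ `M^{0+}(E, j)` PSD on the whole box
  (`termMatrix0p_posSemidef_on_box`); `0⁻` with three closed-form inequalities
  (`termMatrix0m_posSemidef_on_box`);
* §3 RULE (T) at the apex: in the dominated node configuration of
  `ConformalBootstrap3D.MixedEvenTail` (apex node `a`, ratios `qd, qr ∈ (0, 1]`), for `E ≥ E_T` and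
  `j ≤ E` every entry satisfies `|M_ik − ĉ_ik 𝒫_{E,j}(z_a, z̄_a)| ≤ 𝒫_{E,j}(z_a, z̄_a) · ρ_ik(E_T)` with the
  apex main terms `ĉ_ik = c_a v_a^s` and radii `ρ_ik` = sums of `apexRest`; the sign–radius vertex test on
  `(ĉ_ii − ρ_ii, |ĉ_ik| + ρ_ik)` gives `M^{0+}(E, j)` PSD for ALL `E ≥ E_T`, `j ≤ E`
  (`termMatrix0p_posSemidef_of_apex`; `0⁻`: `termMatrix0m_posSemidef_of_apex`);
* §4 the HEAVY range: (M) for `E ∈ [E₀, E_T)` on the twist domain `j + τ ≤ E` and (T) for `E ≥ E_T`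
  give `Pos0p` / `Pos0m` at EVERY `(Δ, ℓ)` with `Δ ≥ E₀` and `unitarityBound3D ℓ ≤ Δ`
  (`pos0p_heavy`, `pos0m_heavy`; non-regular points by right limits) — the items `tail_0p`, `tail_0m` of
  `O2Obligations`;
* §5 LIGHT cells with kernel-computed tables: the entry tables of the cell rules of
  `O2NeutralSectorsCells` are the corner numbers `boxLo0p/boxRad0p … q.2 (a+n) (b+n)`
  (`pos0p_on_cell_Ico_of_corners`, `pos0m_on_cell_Ico_of_corners`), and the cell tails off a head set
  `S ⊇ {(n, j) in range : n < N₀}` with `a + N₀ ≥ E₀` follow from the same (M)/(T) facts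
  (`cellTail0p_of_termwise`, `cellTail0m_of_termwise`).

HONEST SCOPE.  External dimensions are a POINT `D` (no box in `(Δ_φ, Δ_s, Δ_t)`); the node configuration
hypotheses of rule (T) are the verifier's to meet; charged sectors untreated; nothing here decides an
instance.  honest framing: shared numerical engines serving client cells; rigour lives in the
verifiers; every published number belongs to a client cell's ledger, not to the engines group.

Sources.  Chester–Landry–Liu–Poland–Simmons-Duffin–Su–Vichi, JHEP 06 (2020) 142, §3.1, App. A
(`ChesterEtAl2020`); Hogervorst–Rychkov (2013), §3 eqs. (3.6), (3.9) (`HogervorstRychkov2013`);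
Kos–Poland–Simmons-Duffin (2014), §3.3, §4 (`KosPolandSimmonsduffin2014`); Hladík (2017), Thm. 1
(`Hladik2017`).
-/

namespace Literature.MathematicalPhysics.QuantumFieldTheory.O2NeutralSectorsTail

open Finset Set Matrix Filter Topology
open Literature.MathematicalPhysics.QuantumFieldTheory.O2ThreeScalarCrossing
open Literature.MathematicalPhysics.QuantumFieldTheory.O2ThreeScalarSystem
open Literature.MathematicalPhysics.QuantumFieldTheory.O2OPEScanBridge
open Literature.MathematicalPhysics.QuantumFieldTheory.O2ScanObligations
open Literature.MathematicalPhysics.QuantumFieldTheory.O2NeutralSectorsTermwise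
open Literature.MathematicalPhysics.QuantumFieldTheory.O2NeutralSectorsHead
open Literature.MathematicalPhysics.QuantumFieldTheory.O2NeutralSectorsCells
open Literature.Analysis.ValidatedNumerics.ParametricIntervalPosSemidef (signRadMatrix
  posSemidef_of_forall_signRadMatrix posSemidef_symm_fin_two_of_bounds)
open ConformalBootstrap3D (IsConformalBlock3D IsRegularPoint3D unitarityBound3D accidentalDegeneracy3D
  crossF zMono hrCoeff legendreLam InDescendantRange zMono_nonneg twoWeightEval twoWeightEval_neg
  cornerBound₂ cornerBound₂_le apexRest apexRest_nonneg apexRest_anti_level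
  abs_pointFunctional_crossF_zMono_sub_apex_le eventually_isRegularPoint3D_nhdsGT_of_bound_le
  natCast_add_le_of_unitarityBound3D_lt natCast_add_half_le_unitarityBound3D headCellSumI headAbsSumI)

/-! ### §1 Entries as two-weight evaluations -/

/-- Direct weights `c_ik(m)` of the `0⁺` term-matrix entries at node `m` (linear in the weight rows).
[cite: ChesterEtAl2020, App. «Crossing vectors» (`V⃗_{0⁺,Δ,ℓ⁺}`)] -/
def cw0p (F : ScanFunctional) (i k : Fin 3) (m : Fin F.M) : ℝ :=
  !![2 * F.w m 12, F.w m 17 + F.w m 18, F.w m 15 + F.w m 16;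
     F.w m 17 + F.w m 18, 2 * F.w m 0 - 2 * F.w m 2, F.w m 8 + F.w m 9 - F.w m 10 - F.w m 11;
     F.w m 15 + F.w m 16, F.w m 8 + F.w m 9 - F.w m 10 - F.w m 11, 2 * F.w m 3 - 2 * F.w m 5] i k

/-- Reflected weights `d_ik(m)` of the `0⁺` term-matrix entries at node `m`.
[cite: ChesterEtAl2020, App. «Crossing vectors» (`V⃗_{0⁺,Δ,ℓ⁺}`)] -/
def dw0p (F : ScanFunctional) (i k : Fin 3) (m : Fin F.M) : ℝ :=
  !![2 * F.w m 12, F.w m 17 - F.w m 18, F.w m 15 - F.w m 16;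
     F.w m 17 - F.w m 18, 2 * F.w m 0 + 2 * F.w m 2, F.w m 8 + F.w m 9 + F.w m 10 + F.w m 11;
     F.w m 15 - F.w m 16, F.w m 8 + F.w m 9 + F.w m 10 + F.w m 11, 2 * F.w m 3 + 2 * F.w m 5] i k

/-- Labels (hence exponents `D.expo`) of the `0⁺` term-matrix entries.
[cite: ChesterEtAl2020, App. «Crossing vectors» (`V⃗_{0⁺,Δ,ℓ⁺}`)] -/
def lab0p (i k : Fin 3) : Label :=
  !![Label.ssss, Label.φφss, Label.ttss; Label.φφss, Label.φφφφ, Label.ttφφ;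
     Label.ttss, Label.ttφφ, Label.tttt] i k

/-- Direct weights of the `0⁻` term-matrix entries at node `m`.
[cite: ChesterEtAl2020, App. «Crossing vectors» (`V⃗_{0⁻,Δ,ℓ⁻}`)] -/
def cw0m (F : ScanFunctional) (i k : Fin 2) (m : Fin F.M) : ℝ :=
  !![2 * F.w m 0 - 4 * F.w m 1 + 2 * F.w m 2, -F.w m 8 + F.w m 9 + F.w m 10 - F.w m 11;
     -F.w m 8 + F.w m 9 + F.w m 10 - F.w m 11, 2 * F.w m 3 - 4 * F.w m 4 + 2 * F.w m 5] i k

/-- Reflected weights of the `0⁻` term-matrix entries at node `m`.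
[cite: ChesterEtAl2020, App. «Crossing vectors» (`V⃗_{0⁻,Δ,ℓ⁻}`)] -/
def dw0m (F : ScanFunctional) (i k : Fin 2) (m : Fin F.M) : ℝ :=
  !![2 * F.w m 0 - 4 * F.w m 1 - 2 * F.w m 2, -F.w m 8 + F.w m 9 - F.w m 10 + F.w m 11;
     -F.w m 8 + F.w m 9 - F.w m 10 + F.w m 11, 2 * F.w m 3 - 4 * F.w m 4 - 2 * F.w m 5] i k

/-- Labels of the `0⁻` term-matrix entries. [cite: ChesterEtAl2020, App. «Crossing vectors» (`V⃗_{0⁻,Δ,ℓ⁻}`)] -/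
def lab0m (i k : Fin 2) : Label :=
  !![Label.φφφφ, Label.ttφφ; Label.ttφφ, Label.tttt] i k

/-- **Every `0⁺` entry is a two-weight evaluation of `𝒫_{E,j}`.**
[cite: HogervorstRychkov2013, §3 eq. (3.6)] [cite: ChesterEtAl2020, App. «Crossing vectors»] -/
theorem termMatrix0p_apply_eq_twoWeightEval (F : ScanFunctional) (D : Dims) (E : ℝ) (j : ℕ)
    (i k : Fin 3) :
    termMatrix0p F D E j i k =
      twoWeightEval (cw0p F i k) (dw0p F i k) F.z F.zb (D.expo (lab0p i k)) (zMono E j) := by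
  fin_cases i <;> fin_cases k <;> simp [termMatrix0p, lab0p] <;>
    simp only [nodeEval_apply, crossF, twoWeightEval, Finset.mul_sum, ← Finset.sum_add_distrib,
      ← Finset.sum_sub_distrib] <;>
    exact Finset.sum_congr rfl fun m _ => by simp [cw0p, dw0p]; ring

/-- **Every `0⁻` entry is a two-weight evaluation of `𝒫_{E,j}`.**
[cite: HogervorstRychkov2013, §3 eq. (3.6)] [cite: ChesterEtAl2020, App. «Crossing vectors»] -/
theorem termMatrix0m_apply_eq_twoWeightEval (F : ScanFunctional) (D : Dims) (E : ℝ) (j : ℕ)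
    (i k : Fin 2) :
    termMatrix0m F D E j i k =
      twoWeightEval (cw0m F i k) (dw0m F i k) F.z F.zb (D.expo (lab0m i k)) (zMono E j) := by
  fin_cases i <;> fin_cases k <;> simp [termMatrix0m, lab0m] <;>
    simp only [nodeEval_apply, crossF, twoWeightEval, Finset.mul_sum, ← Finset.sum_add_distrib,
      ← Finset.sum_sub_distrib, ← Finset.sum_neg_distrib] <;>
    exact Finset.sum_congr rfl fun m _ => by simp [cw0m, dw0m]; ring

/-- Two-sided corner enclosure of a two-weight evaluation on a box (`s` fixed).
[cite: HogervorstRychkov2013, §3 eq. (3.6)] -/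
theorem twoWeightEval_mem_Icc_corner (F : ScanFunctional) (c d : Fin F.M → ℝ) (j : ℕ) {E₁ E₂ E : ℝ}
    (hE : E ∈ Icc E₁ E₂) (s : ℝ) :
    cornerBound₂ c d F.z F.zb j E₁ E₂ s s ≤ twoWeightEval c d F.z F.zb s (zMono E j) ∧
      twoWeightEval c d F.z F.zb s (zMono E j) ≤ -cornerBound₂ (-c) (-d) F.z F.zb j E₁ E₂ s s := by
  refine ⟨cornerBound₂_le c d F.z F.zb F.hz F.hzb j hE ⟨le_rfl, le_rfl⟩, ?_⟩
  have h := cornerBound₂_le (-c) (-d) F.z F.zb F.hz F.hzb j hE (s := s) ⟨le_rfl, le_rfl⟩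
  rw [twoWeightEval_neg] at h
  linarith

/-- `lo ≤ x ≤ hi ⇒ |x| ≤ max (−lo) hi` (private helper). [folklore] -/
private theorem abs_le_max_of_mem {x lo hi : ℝ} (h1 : lo ≤ x) (h2 : x ≤ hi) : |x| ≤ max (-lo) hi := by
  rw [abs_le]
  exact ⟨by linarith [le_max_left (-lo) hi], h2.trans (le_max_right _ _)⟩

/-! ### §2 Rule (M): term matrices on a box -/

/-- Lower corner numbers of the diagonal `0⁺` entries on the box `E ∈ [E₁, E₂]`.
[cite: HogervorstRychkov2013, §3 eq. (3.6)] -/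
noncomputable def boxLo0p (F : ScanFunctional) (D : Dims) (j : ℕ) (E₁ E₂ : ℝ) : Fin 3 → ℝ := fun i =>
  cornerBound₂ (cw0p F i i) (dw0p F i i) F.z F.zb j E₁ E₂ (D.expo (lab0p i i)) (D.expo (lab0p i i))

/-- Radius numbers of the `0⁺` entries on the box `E ∈ [E₁, E₂]`: `max(−cb(c,d), −cb(−c,−d))`.
[cite: HogervorstRychkov2013, §3 eq. (3.6)] -/
noncomputable def boxRad0p (F : ScanFunctional) (D : Dims) (j : ℕ) (E₁ E₂ : ℝ) : Matrix (Fin 3) (Fin 3) ℝ :=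
  Matrix.of fun i k =>
    max (-cornerBound₂ (cw0p F i k) (dw0p F i k) F.z F.zb j E₁ E₂ (D.expo (lab0p i k)) (D.expo (lab0p i k)))
      (-cornerBound₂ (-cw0p F i k) (-dw0p F i k) F.z F.zb j E₁ E₂ (D.expo (lab0p i k))
        (D.expo (lab0p i k)))

/-- **Rule (M), sector `0⁺`.** If the four sign–radius vertex matrices of the box numbers
`(boxLo0p, boxRad0p)` are PSD then `M^{0+}(E, j)` is PSD for every `E ∈ [E₁, E₂]`.
[cite: HogervorstRychkov2013, §3 eq. (3.6)] [cite: Hladik2017, Thm. 1 ((2) ⇒ (1))] -/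
theorem termMatrix0p_posSemidef_on_box (F : ScanFunctional) (D : Dims) (j : ℕ) {E₁ E₂ : ℝ}
    (hvert : ∀ z : Fin 3 → Bool, (signRadMatrix (boxLo0p F D j E₁ E₂) (boxRad0p F D j E₁ E₂) z).PosSemidef) :
    ∀ E ∈ Icc E₁ E₂, (termMatrix0p F D E j).PosSemidef := by
  intro E hE
  refine posSemidef_of_forall_signRadMatrix hvert (isHermitian_termMatrix0p F D E j) (fun i => ?_)
    (fun i k _ => ?_)
  · rw [termMatrix0p_apply_eq_twoWeightEval]
    exact (twoWeightEval_mem_Icc_corner F _ _ j hE _).1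
  · rw [boxRad0p, Matrix.of_apply, termMatrix0p_apply_eq_twoWeightEval]
    have h := twoWeightEval_mem_Icc_corner F (cw0p F i k) (dw0p F i k) j hE (D.expo (lab0p i k))
    exact abs_le_max_of_mem h.1 h.2

/-- **Rule (M), sector `0⁻`** (closed form): with `X = cb(c₀₀, d₀₀)`, `Y = cb(c₁₁, d₁₁)`,
`R = max(−cb(c₀₁, d₀₁), −cb(−c₀₁, −d₀₁))`, the checks `X ≥ 0`, `Y ≥ 0`, `R² ≤ X Y` give `M^{0−}(E, j)` PSD
for every `E ∈ [E₁, E₂]`. [cite: HogervorstRychkov2013, §3 eq. (3.6)] -/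
theorem termMatrix0m_posSemidef_on_box (F : ScanFunctional) (D : Dims) (j : ℕ) {E₁ E₂ : ℝ}
    (hX : 0 ≤ cornerBound₂ (cw0m F 0 0) (dw0m F 0 0) F.z F.zb j E₁ E₂ (D.expo (lab0m 0 0))
      (D.expo (lab0m 0 0)))
    (hY : 0 ≤ cornerBound₂ (cw0m F 1 1) (dw0m F 1 1) F.z F.zb j E₁ E₂ (D.expo (lab0m 1 1))
      (D.expo (lab0m 1 1)))
    (hR : max (-cornerBound₂ (cw0m F 0 1) (dw0m F 0 1) F.z F.zb j E₁ E₂ (D.expo (lab0m 0 1))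
          (D.expo (lab0m 0 1)))
        (-cornerBound₂ (-cw0m F 0 1) (-dw0m F 0 1) F.z F.zb j E₁ E₂ (D.expo (lab0m 0 1))
          (D.expo (lab0m 0 1))) ^ 2 ≤
      cornerBound₂ (cw0m F 0 0) (dw0m F 0 0) F.z F.zb j E₁ E₂ (D.expo (lab0m 0 0)) (D.expo (lab0m 0 0)) *
        cornerBound₂ (cw0m F 1 1) (dw0m F 1 1) F.z F.zb j E₁ E₂ (D.expo (lab0m 1 1))
          (D.expo (lab0m 1 1))) :
    ∀ E ∈ Icc E₁ E₂, (termMatrix0m F D E j).PosSemidef := by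
  intro E hE
  set A := termMatrix0m F D E j with hAdef
  have hsym : A 1 0 = A 0 1 := by
    have h := (isHermitian_termMatrix0m F D E j).apply 0 1
    rw [star_trivial] at h
    exact h
  have hA2 : A = !![A 0 0, A 0 1; A 0 1, A 1 1] := by
    ext i k; fin_cases i <;> fin_cases k <;> simp [hsym]
  have h00 := twoWeightEval_mem_Icc_corner F (cw0m F 0 0) (dw0m F 0 0) j hE (D.expo (lab0m 0 0))
  have h11 := twoWeightEval_mem_Icc_corner F (cw0m F 1 1) (dw0m F 1 1) j hE (D.expo (lab0m 1 1))
  have h01 := twoWeightEval_mem_Icc_corner F (cw0m F 0 1) (dw0m F 0 1) j hE (D.expo (lab0m 0 1))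
  have habs := abs_le_max_of_mem h01.1 h01.2
  rw [← termMatrix0m_apply_eq_twoWeightEval] at h00 h11 habs
  rw [hA2]
  refine posSemidef_symm_fin_two_of_bounds hX hY ?_ h00.1 h11.1 ⟨neg_le_of_abs_le habs, le_of_abs_le habs⟩
  rw [max_le_iff]
  constructor <;> nlinarith [hR]

/-! ### §3 Rule (T): term matrices at the apex -/

/-- A two-weight evaluation is the sum of two point functionals with weights `(c ± d)/2`.
[cite: HogervorstRychkov2013, §3 eq. (3.6)] -/
theorem twoWeightEval_eq_pointFunctional_add {N : ℕ} (c d z zb : Fin N → ℝ) (s : ℝ) (g : ℝ → ℝ → ℝ) :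
    twoWeightEval c d z zb s g =
      ConformalBootstrap3D.pointFunctional (fun m => (c m + d m) / 2) z zb (crossF s (-1) g) +
        ConformalBootstrap3D.pointFunctional (fun m => (c m - d m) / 2) z zb (crossF s 1 g) := by
  simp only [twoWeightEval, ConformalBootstrap3D.pointFunctional_apply, crossF, ← Finset.sum_add_distrib]
  exact Finset.sum_congr rfl fun m _ => by ring

/-- The apex radius of a two-weight evaluation: `R((c+d)/2; s, T) + R((c−d)/2; s, T)`.
[cite: HogervorstRychkov2013, §3 eq. (3.6)] -/
noncomputable def apexRadTW (F : ScanFunctional) (c d : Fin F.M → ℝ) (a : Fin F.M)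
    (qd qr : Fin F.M → ℝ) (s T : ℝ) : ℝ :=
  apexRest (fun m => (c m + d m) / 2) F.z F.zb a qd qr s T +
    apexRest (fun m => (c m - d m) / 2) F.z F.zb a qd qr s T

/-- The apex radius is non-increasing in the level. [cite: HogervorstRychkov2013, §3 eq. (3.6)] -/
theorem apexRadTW_anti_level (F : ScanFunctional) (c d : Fin F.M → ℝ) (a : Fin F.M)
    {qd qr : Fin F.M → ℝ} (hqd : ∀ m, 0 < qd m ∧ qd m ≤ 1) (hqr : ∀ m, 0 < qr m ∧ qr m ≤ 1) (s : ℝ)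
    {T T' : ℝ} (h : T ≤ T') : apexRadTW F c d a qd qr s T' ≤ apexRadTW F c d a qd qr s T :=
  add_le_add (apexRest_anti_level _ F.z F.zb F.hz F.hzb a qd qr hqd hqr s h)
    (apexRest_anti_level _ F.z F.zb F.hz F.hzb a qd qr hqd hqr s h)

/-- **Two-sided apex estimate for a two-weight evaluation** (dominated node configuration, `j ≤ E`):
`|T(c, d; s)[𝒫_{E,j}] − c_a v_a^s 𝒫_{E,j}(z_a, z̄_a)| ≤ 𝒫_{E,j}(z_a, z̄_a) · apexRadTW(c, d; s, E)`.
[cite: HogervorstRychkov2013, §3 eq. (3.6)] -/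
theorem abs_twoWeightEval_sub_apex_le (F : ScanFunctional) (hord : ∀ m, F.zb m ≤ F.z m) (a : Fin F.M)
    (qd qr : Fin F.M → ℝ) (hqd : ∀ m, 0 < qd m) (hqr : ∀ m, 0 < qr m)
    (hdomd : ∀ m, F.z m * F.zb m ≤ qd m ^ 2 * (F.z a * F.zb a) ∧ F.z m ≤ qd m * F.z a)
    (hdomr : ∀ m, (1 - F.z m) * (1 - F.zb m) ≤ qr m ^ 2 * (F.z a * F.zb a) ∧ 1 - F.zb m ≤ qr m * F.z a)
    {E : ℝ} {j : ℕ} (hjE : (j : ℝ) ≤ E) (c d : Fin F.M → ℝ) (s : ℝ) :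
    |twoWeightEval c d F.z F.zb s (zMono E j) -
        c a * ((1 - F.z a) * (1 - F.zb a)) ^ s * zMono E j (F.z a) (F.zb a)| ≤
      zMono E j (F.z a) (F.zb a) * apexRadTW F c d a qd qr s E := by
  have h1 := abs_pointFunctional_crossF_zMono_sub_apex_le (fun m => (c m + d m) / 2) F.z F.zb F.hz F.hzb
    hord a qd qr hqd hqr hdomd hdomr hjE s (-1) (by norm_num)
  have h2 := abs_pointFunctional_crossF_zMono_sub_apex_le (fun m => (c m - d m) / 2) F.z F.zb F.hz F.hzb
    hord a qd qr hqd hqr hdomd hdomr hjE s 1 (by norm_num)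
  beta_reduce at h1 h2
  rw [twoWeightEval_eq_pointFunctional_add, apexRadTW, mul_add]
  set P := zMono E j (F.z a) (F.zb a)
  set v := ((1 - F.z a) * (1 - F.zb a)) ^ s
  set A := ConformalBootstrap3D.pointFunctional (fun m => (c m + d m) / 2) F.z F.zb (crossF s (-1) (zMono E j))
  set B := ConformalBootstrap3D.pointFunctional (fun m => (c m - d m) / 2) F.z F.zb (crossF s 1 (zMono E j))
  have e : A + B - c a * v * P = (A - (c a + d a) / 2 * v * P) + (B - (c a - d a) / 2 * v * P) := by ring
  rw [e]
  exact (abs_add_le _ _).trans (add_le_add h1 h2)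

/-- Apex lower numbers of the diagonal `0⁺` entries: `c_ii(a) v_a^{s_ii} − apexRadTW(c_ii, d_ii; s_ii, T)`.
[cite: HogervorstRychkov2013, §3 eq. (3.6)] -/
noncomputable def apexLo0p (F : ScanFunctional) (D : Dims) (a : Fin F.M) (qd qr : Fin F.M → ℝ) (T : ℝ) :
    Fin 3 → ℝ := fun i =>
  cw0p F i i a * ((1 - F.z a) * (1 - F.zb a)) ^ D.expo (lab0p i i) -
    apexRadTW F (cw0p F i i) (dw0p F i i) a qd qr (D.expo (lab0p i i)) T

/-- Apex radius numbers of the `0⁺` entries: `|c_ik(a)| v_a^{s_ik} + apexRadTW(c_ik, d_ik; s_ik, T)`.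
[cite: HogervorstRychkov2013, §3 eq. (3.6)] -/
noncomputable def apexRad0p (F : ScanFunctional) (D : Dims) (a : Fin F.M) (qd qr : Fin F.M → ℝ) (T : ℝ) :
    Matrix (Fin 3) (Fin 3) ℝ := Matrix.of fun i k =>
  |cw0p F i k a * ((1 - F.z a) * (1 - F.zb a)) ^ D.expo (lab0p i k)| +
    apexRadTW F (cw0p F i k) (dw0p F i k) a qd qr (D.expo (lab0p i k)) T

/-- The sign–radius matrices are linear in `(lo, r)`. [cite: Rohn1996Checking, §3.4 eq. (3.4)] -/
theorem signRadMatrix_smul {ι : Type*} [DecidableEq ι] (P : ℝ) (lo : ι → ℝ) (r : Matrix ι ι ℝ)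
    (z : ι → Bool) : signRadMatrix (P • lo) (P • r) z = P • signRadMatrix lo r z := by
  ext i k
  simp only [Literature.Analysis.ValidatedNumerics.ParametricIntervalPosSemidef.signRadMatrix_apply,
    Matrix.smul_apply, Pi.smul_apply, smul_eq_mul]
  split_ifs <;> ring

/-- **Rule (T), sector `0⁺`.** In the dominated node configuration, if the four sign–radius vertex
matrices of the apex numbers `(apexLo0p … E_T, apexRad0p … E_T)` are PSD then `M^{0+}(E, j)` is PSD for
every real `E ≥ E_T` and every `j ≤ E`. [cite: HogervorstRychkov2013, §3 eq. (3.6)]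
[cite: Hladik2017, Thm. 1 ((2) ⇒ (1))] -/
theorem termMatrix0p_posSemidef_of_apex (F : ScanFunctional) (D : Dims) (hord : ∀ m, F.zb m ≤ F.z m)
    (a : Fin F.M) (qd qr : Fin F.M → ℝ) (hqd : ∀ m, 0 < qd m ∧ qd m ≤ 1)
    (hqr : ∀ m, 0 < qr m ∧ qr m ≤ 1)
    (hdomd : ∀ m, F.z m * F.zb m ≤ qd m ^ 2 * (F.z a * F.zb a) ∧ F.z m ≤ qd m * F.z a)
    (hdomr : ∀ m, (1 - F.z m) * (1 - F.zb m) ≤ qr m ^ 2 * (F.z a * F.zb a) ∧ 1 - F.zb m ≤ qr m * F.z a)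
    {ET : ℝ} (hvert : ∀ z : Fin 3 → Bool,
      (signRadMatrix (apexLo0p F D a qd qr ET) (apexRad0p F D a qd qr ET) z).PosSemidef) :
    ∀ E : ℝ, ET ≤ E → ∀ j : ℕ, (j : ℝ) ≤ E → (termMatrix0p F D E j).PosSemidef := by
  intro E hE j hjE
  set P := zMono E j (F.z a) (F.zb a) with hPdef
  have hP : 0 ≤ P := zMono_nonneg E j (F.hz a).1.le (F.hzb a).1.le
  have hqd0 : ∀ m, 0 < qd m := fun m => (hqd m).1
  have hqr0 : ∀ m, 0 < qr m := fun m => (hqr m).1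
  have hdev : ∀ i k, |termMatrix0p F D E j i k -
      cw0p F i k a * ((1 - F.z a) * (1 - F.zb a)) ^ D.expo (lab0p i k) * P| ≤
      P * apexRadTW F (cw0p F i k) (dw0p F i k) a qd qr (D.expo (lab0p i k)) ET := by
    intro i k
    rw [termMatrix0p_apply_eq_twoWeightEval]
    exact (abs_twoWeightEval_sub_apex_le F hord a qd qr hqd0 hqr0 hdomd hdomr hjE _ _ _).trans
      (mul_le_mul_of_nonneg_left (apexRadTW_anti_level F _ _ a hqd hqr _ hE) hP)
  have hvert' : ∀ z : Fin 3 → Bool,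
      (signRadMatrix (P • apexLo0p F D a qd qr ET) (P • apexRad0p F D a qd qr ET) z).PosSemidef := by
    intro z
    rw [signRadMatrix_smul]
    exact (hvert z).smul hP
  refine posSemidef_of_forall_signRadMatrix hvert' (isHermitian_termMatrix0p F D E j) (fun i => ?_)
    (fun i k _ => ?_)
  · have h := hdev i i
    rw [abs_le] at h
    simp only [Pi.smul_apply, smul_eq_mul, apexLo0p]
    nlinarith [h.1]
  · have h := hdev i k
    simp only [Matrix.smul_apply, smul_eq_mul, apexRad0p, Matrix.of_apply]
    have hmain : |cw0p F i k a * ((1 - F.z a) * (1 - F.zb a)) ^ D.expo (lab0p i k) * P| =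
        P * |cw0p F i k a * ((1 - F.z a) * (1 - F.zb a)) ^ D.expo (lab0p i k)| := by
      rw [abs_mul, abs_of_nonneg hP, mul_comm]
    calc |termMatrix0p F D E j i k|
        ≤ |cw0p F i k a * ((1 - F.z a) * (1 - F.zb a)) ^ D.expo (lab0p i k) * P| +
            |termMatrix0p F D E j i k -
              cw0p F i k a * ((1 - F.z a) * (1 - F.zb a)) ^ D.expo (lab0p i k) * P| := by
          have := abs_add_le (cw0p F i k a * ((1 - F.z a) * (1 - F.zb a)) ^ D.expo (lab0p i k) * P)
            (termMatrix0p F D E j i k -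
              cw0p F i k a * ((1 - F.z a) * (1 - F.zb a)) ^ D.expo (lab0p i k) * P)
          rwa [add_sub_cancel] at this
      _ ≤ P * |cw0p F i k a * ((1 - F.z a) * (1 - F.zb a)) ^ D.expo (lab0p i k)| +
            P * apexRadTW F (cw0p F i k) (dw0p F i k) a qd qr (D.expo (lab0p i k)) ET := by
          rw [← hmain]; exact add_le_add le_rfl h
      _ = P * (|cw0p F i k a * ((1 - F.z a) * (1 - F.zb a)) ^ D.expo (lab0p i k)| +
            apexRadTW F (cw0p F i k) (dw0p F i k) a qd qr (D.expo (lab0p i k)) ET) := by ring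

/-- **Rule (T), sector `0⁻`** (closed form): with `X_T = c₀₀(a) v_a^{s₀₀} − ρ₀₀(E_T)`,
`Y_T = c₁₁(a) v_a^{s₁₁} − ρ₁₁(E_T)`, `Z_T = |c₀₁(a)| v_a^{s₀₁} + ρ₀₁(E_T)` (`ρ = apexRadTW`), the checks
`X_T ≥ 0`, `Y_T ≥ 0`, `Z_T² ≤ X_T Y_T` give `M^{0−}(E, j)` PSD for every `E ≥ E_T`, `j ≤ E`.
[cite: HogervorstRychkov2013, §3 eq. (3.6)] -/
theorem termMatrix0m_posSemidef_of_apex (F : ScanFunctional) (D : Dims) (hord : ∀ m, F.zb m ≤ F.z m)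
    (a : Fin F.M) (qd qr : Fin F.M → ℝ) (hqd : ∀ m, 0 < qd m ∧ qd m ≤ 1)
    (hqr : ∀ m, 0 < qr m ∧ qr m ≤ 1)
    (hdomd : ∀ m, F.z m * F.zb m ≤ qd m ^ 2 * (F.z a * F.zb a) ∧ F.z m ≤ qd m * F.z a)
    (hdomr : ∀ m, (1 - F.z m) * (1 - F.zb m) ≤ qr m ^ 2 * (F.z a * F.zb a) ∧ 1 - F.zb m ≤ qr m * F.z a)
    {ET : ℝ}
    (hX : 0 ≤ cw0m F 0 0 a * ((1 - F.z a) * (1 - F.zb a)) ^ D.expo (lab0m 0 0) -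
      apexRadTW F (cw0m F 0 0) (dw0m F 0 0) a qd qr (D.expo (lab0m 0 0)) ET)
    (hY : 0 ≤ cw0m F 1 1 a * ((1 - F.z a) * (1 - F.zb a)) ^ D.expo (lab0m 1 1) -
      apexRadTW F (cw0m F 1 1) (dw0m F 1 1) a qd qr (D.expo (lab0m 1 1)) ET)
    (hZ : (|cw0m F 0 1 a * ((1 - F.z a) * (1 - F.zb a)) ^ D.expo (lab0m 0 1)| +
        apexRadTW F (cw0m F 0 1) (dw0m F 0 1) a qd qr (D.expo (lab0m 0 1)) ET) ^ 2 ≤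
      (cw0m F 0 0 a * ((1 - F.z a) * (1 - F.zb a)) ^ D.expo (lab0m 0 0) -
          apexRadTW F (cw0m F 0 0) (dw0m F 0 0) a qd qr (D.expo (lab0m 0 0)) ET) *
        (cw0m F 1 1 a * ((1 - F.z a) * (1 - F.zb a)) ^ D.expo (lab0m 1 1) -
          apexRadTW F (cw0m F 1 1) (dw0m F 1 1) a qd qr (D.expo (lab0m 1 1)) ET)) :
    ∀ E : ℝ, ET ≤ E → ∀ j : ℕ, (j : ℝ) ≤ E → (termMatrix0m F D E j).PosSemidef := by
  intro E hE j hjE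
  set P := zMono E j (F.z a) (F.zb a) with hPdef
  have hP : 0 ≤ P := zMono_nonneg E j (F.hz a).1.le (F.hzb a).1.le
  have hqd0 : ∀ m, 0 < qd m := fun m => (hqd m).1
  have hqr0 : ∀ m, 0 < qr m := fun m => (hqr m).1
  have hdev : ∀ i k, |termMatrix0m F D E j i k -
      cw0m F i k a * ((1 - F.z a) * (1 - F.zb a)) ^ D.expo (lab0m i k) * P| ≤
      P * apexRadTW F (cw0m F i k) (dw0m F i k) a qd qr (D.expo (lab0m i k)) ET := by
    intro i k
    rw [termMatrix0m_apply_eq_twoWeightEval]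
    exact (abs_twoWeightEval_sub_apex_le F hord a qd qr hqd0 hqr0 hdomd hdomr hjE _ _ _).trans
      (mul_le_mul_of_nonneg_left (apexRadTW_anti_level F _ _ a hqd hqr _ hE) hP)
  set XT := cw0m F 0 0 a * ((1 - F.z a) * (1 - F.zb a)) ^ D.expo (lab0m 0 0) -
      apexRadTW F (cw0m F 0 0) (dw0m F 0 0) a qd qr (D.expo (lab0m 0 0)) ET
  set YT := cw0m F 1 1 a * ((1 - F.z a) * (1 - F.zb a)) ^ D.expo (lab0m 1 1) -
      apexRadTW F (cw0m F 1 1) (dw0m F 1 1) a qd qr (D.expo (lab0m 1 1)) ET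
  set ZT := |cw0m F 0 1 a * ((1 - F.z a) * (1 - F.zb a)) ^ D.expo (lab0m 0 1)| +
        apexRadTW F (cw0m F 0 1) (dw0m F 0 1) a qd qr (D.expo (lab0m 0 1)) ET
  set A := termMatrix0m F D E j with hAdef
  have hsym : A 1 0 = A 0 1 := by
    have h := (isHermitian_termMatrix0m F D E j).apply 0 1
    rw [star_trivial] at h
    exact h
  have hA2 : A = !![A 0 0, A 0 1; A 0 1, A 1 1] := by
    ext i k; fin_cases i <;> fin_cases k <;> simp [hsym]
  have h00 : P * XT ≤ A 0 0 := by
    have h := hdev 0 0; rw [abs_le] at h; nlinarith [h.1]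
  have h11 : P * YT ≤ A 1 1 := by
    have h := hdev 1 1; rw [abs_le] at h; nlinarith [h.1]
  have h01 : |A 0 1| ≤ P * ZT := by
    have h := hdev 0 1
    rw [abs_le] at h ⊢
    have hm : |cw0m F 0 1 a * ((1 - F.z a) * (1 - F.zb a)) ^ D.expo (lab0m 0 1) * P| =
        P * |cw0m F 0 1 a * ((1 - F.z a) * (1 - F.zb a)) ^ D.expo (lab0m 0 1)| := by
      rw [abs_mul, abs_of_nonneg hP, mul_comm]
    have hb := abs_le.1 (le_of_eq hm)
    constructor <;> nlinarith [hb.1, hb.2, h.1, h.2]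
  rw [hA2]
  refine posSemidef_symm_fin_two_of_bounds (mul_nonneg hP hX) (mul_nonneg hP hY) ?_ h00 h11
    ⟨neg_le_of_abs_le h01, le_of_abs_le h01⟩
  rw [max_le_iff]
  have hZ' : (P * ZT) * (P * ZT) ≤ (P * XT) * (P * YT) := by
    have := mul_le_mul_of_nonneg_left hZ (mul_nonneg hP hP)
    nlinarith [this]
  constructor <;> nlinarith [hZ']

/-! ### §4 The heavy range `Δ ≥ E₀` from (M) and (T) -/

/-- **Heavy range, sector `0⁺`, regular point** (twist-gap domain): termwise PSD of `M^{0+}(E, j)` for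
`E ∈ [E₀, E_T)`, `j + τ ≤ E` (rule (M); `τ ≤ 1`, `τ ≤ E₀`) and for `E ≥ E_T`, `j ≤ E` (rule (T)) give the
`0⁺` sector form `≥ 0` on genuine blocks at every regular `(Δ, ℓ)` with `Δ ≥ E₀`.
[cite: HogervorstRychkov2013, §3 eqs. (3.6), (3.9)] [cite: KosPolandSimmonsduffin2014, §3.3 eq. (3.16)] -/
theorem sector0pForm_nonneg_heavy (F : ScanFunctional) (D : Dims) {E₀ ET τ : ℝ} (hτ1 : τ ≤ 1)
    (hτ0 : τ ≤ E₀)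
    (hM : ∀ (j : ℕ) (E : ℝ), E₀ ≤ E → E < ET → (j : ℝ) + τ ≤ E → (termMatrix0p F D E j).PosSemidef)
    (hT : ∀ E : ℝ, ET ≤ E → ∀ j : ℕ, (j : ℝ) ≤ E → (termMatrix0p F D E j).PosSemidef)
    {Δ : ℝ} {ℓ : ℕ} (hΔ : unitarityBound3D ℓ < Δ) (hreg : ¬ accidentalDegeneracy3D Δ ℓ) (hΔ0 : E₀ ≤ Δ)
    {G : Label → ℝ → ℝ → ℝ} (hG : ∀ L ∈ labels0p, IsConformalBlock3D 0 0 Δ ℓ (G L)) (x₁ x₂ x₃ : ℝ) :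
    0 ≤ sector0pForm F D G x₁ x₂ x₃ := by
  refine sector0pForm_nonneg_of_headMatrix F D hΔ hreg ∅ ?_ (fun q _ hq => ?_) hG x₁ x₂ x₃
  · simp only [headMatrix0p, Finset.sum_empty]
    exact Matrix.PosSemidef.zero
  · have hℓτ : (ℓ : ℝ) + τ ≤ Δ := natCast_add_le_of_unitarityBound3D_lt hτ1 hτ0 hΔ hΔ0
    have h1 : (q.2 : ℝ) ≤ (ℓ : ℝ) + (q.1 : ℝ) := by exact_mod_cast hq.2.1
    have hjE : (q.2 : ℝ) + τ ≤ Δ + (q.1 : ℝ) := by linarith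
    have hjE' : (q.2 : ℝ) ≤ Δ + (q.1 : ℝ) := by linarith [natCast_add_half_le_unitarityBound3D ℓ]
    have hE0 : E₀ ≤ Δ + (q.1 : ℝ) := hΔ0.trans (le_add_of_nonneg_right (Nat.cast_nonneg _))
    by_cases hlt : Δ + (q.1 : ℝ) < ET
    · exact hM q.2 (Δ + (q.1 : ℝ)) hE0 hlt hjE
    · exact hT (Δ + (q.1 : ℝ)) (not_lt.1 hlt) q.2 hjE'

/-- **Heavy range, sector `0⁻`, regular point.**
[cite: HogervorstRychkov2013, §3 eqs. (3.6), (3.9)] [cite: KosPolandSimmonsduffin2014, §3.3 eq. (3.16)] -/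
theorem sector0mForm_nonneg_heavy (F : ScanFunctional) (D : Dims) {E₀ ET τ : ℝ} (hτ1 : τ ≤ 1)
    (hτ0 : τ ≤ E₀)
    (hM : ∀ (j : ℕ) (E : ℝ), E₀ ≤ E → E < ET → (j : ℝ) + τ ≤ E → (termMatrix0m F D E j).PosSemidef)
    (hT : ∀ E : ℝ, ET ≤ E → ∀ j : ℕ, (j : ℝ) ≤ E → (termMatrix0m F D E j).PosSemidef)
    {Δ : ℝ} {ℓ : ℕ} (hΔ : unitarityBound3D ℓ < Δ) (hreg : ¬ accidentalDegeneracy3D Δ ℓ) (hΔ0 : E₀ ≤ Δ)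
    {G : Label → ℝ → ℝ → ℝ} (hG : ∀ L ∈ labels0m, IsConformalBlock3D 0 0 Δ ℓ (G L)) (x₁ x₂ : ℝ) :
    0 ≤ sector0mForm F D G x₁ x₂ := by
  refine sector0mForm_nonneg_of_headMatrix F D hΔ hreg ∅ ?_ (fun q _ hq => ?_) hG x₁ x₂
  · simp only [headMatrix0m, Finset.sum_empty]
    exact Matrix.PosSemidef.zero
  · have hℓτ : (ℓ : ℝ) + τ ≤ Δ := natCast_add_le_of_unitarityBound3D_lt hτ1 hτ0 hΔ hΔ0
    have h1 : (q.2 : ℝ) ≤ (ℓ : ℝ) + (q.1 : ℝ) := by exact_mod_cast hq.2.1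
    have hjE : (q.2 : ℝ) + τ ≤ Δ + (q.1 : ℝ) := by linarith
    have hjE' : (q.2 : ℝ) ≤ Δ + (q.1 : ℝ) := by linarith [natCast_add_half_le_unitarityBound3D ℓ]
    have hE0 : E₀ ≤ Δ + (q.1 : ℝ) := hΔ0.trans (le_add_of_nonneg_right (Nat.cast_nonneg _))
    by_cases hlt : Δ + (q.1 : ℝ) < ET
    · exact hM q.2 (Δ + (q.1 : ℝ)) hE0 hlt hjE
    · exact hT (Δ + (q.1 : ℝ)) (not_lt.1 hlt) q.2 hjE'

/-- **Heavy range, sector `0⁺`, all points**: `Pos0p` at every `(Δ, ℓ)` with `unitarityBound3D ℓ ≤ Δ`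
and `Δ ≥ E₀` (non-regular points by right limits).
[cite: KosPolandSimmonsduffin2014, §3.3 eq. (3.16), §4 eqs. (4.2)–(4.3)] [cite: ChesterEtAl2020, §3.1] -/
theorem pos0p_heavy (F : ScanFunctional) (D : Dims) {E₀ ET τ : ℝ} (hτ1 : τ ≤ 1) (hτ0 : τ ≤ E₀)
    (hM : ∀ (j : ℕ) (E : ℝ), E₀ ≤ E → E < ET → (j : ℝ) + τ ≤ E → (termMatrix0p F D E j).PosSemidef)
    (hT : ∀ E : ℝ, ET ≤ E → ∀ j : ℕ, (j : ℝ) ≤ E → (termMatrix0p F D E j).PosSemidef) :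
    ∀ ℓ : ℕ, ∀ Δ : ℝ, unitarityBound3D ℓ ≤ Δ → E₀ ≤ Δ → Pos0p F.toFunctional D Δ ℓ := by
  intro ℓ Δ hbd hΔ0
  by_cases hr : IsRegularPoint3D Δ ℓ
  · exact pos0p_of_forall_sector0pForm_nonneg F D fun G hG =>
      sector0pForm_nonneg_heavy F D hτ1 hτ0 hM hT (lt_of_le_of_ne hbd (Ne.symm hr.1)) hr.2 hΔ0 hG
  · refine pos0p_of_eventually_right F D hr ?_
    filter_upwards [eventually_isRegularPoint3D_nhdsGT_of_bound_le hbd, self_mem_nhdsWithin]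
      with Δ' hΔ' hgt
    have hgt' : Δ < Δ' := Set.mem_Ioi.1 hgt
    exact ⟨hΔ', fun G hG => sector0pForm_nonneg_heavy F D hτ1 hτ0 hM hT (lt_of_le_of_lt hbd hgt') hΔ'.2
      (hΔ0.trans hgt'.le) hG⟩

/-- **Heavy range, sector `0⁻`, all points.**
[cite: KosPolandSimmonsduffin2014, §3.3 eq. (3.16), §4 eqs. (4.2)–(4.3)] [cite: ChesterEtAl2020, §3.1] -/
theorem pos0m_heavy (F : ScanFunctional) (D : Dims) {E₀ ET τ : ℝ} (hτ1 : τ ≤ 1) (hτ0 : τ ≤ E₀)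
    (hM : ∀ (j : ℕ) (E : ℝ), E₀ ≤ E → E < ET → (j : ℝ) + τ ≤ E → (termMatrix0m F D E j).PosSemidef)
    (hT : ∀ E : ℝ, ET ≤ E → ∀ j : ℕ, (j : ℝ) ≤ E → (termMatrix0m F D E j).PosSemidef) :
    ∀ ℓ : ℕ, ∀ Δ : ℝ, unitarityBound3D ℓ ≤ Δ → E₀ ≤ Δ → Pos0m F.toFunctional D Δ ℓ := by
  intro ℓ Δ hbd hΔ0
  by_cases hr : IsRegularPoint3D Δ ℓ
  · exact pos0m_of_forall_sector0mForm_nonneg F D fun G hG =>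
      sector0mForm_nonneg_heavy F D hτ1 hτ0 hM hT (lt_of_le_of_ne hbd (Ne.symm hr.1)) hr.2 hΔ0 hG
  · refine pos0m_of_eventually_right F D hr ?_
    filter_upwards [eventually_isRegularPoint3D_nhdsGT_of_bound_le hbd, self_mem_nhdsWithin]
      with Δ' hΔ' hgt
    have hgt' : Δ < Δ' := Set.mem_Ioi.1 hgt
    exact ⟨hΔ', fun G hG => sector0mForm_nonneg_heavy F D hτ1 hτ0 hM hT (lt_of_le_of_lt hbd hgt') hΔ'.2
      (hΔ0.trans hgt'.le) hG⟩

/-! ### §5 Light cells with kernel-computed tables; cell tails from (M)/(T) -/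

/-- **`0⁺` cell rule with corner tables**: the entry tables of `pos0p_on_cell_Ico` taken to be the corner
numbers of the boxes `E ∈ [a+n, b+n]` (`boxLo0p F D j (a+n) (b+n) i`, `boxRad0p … i k`); the reader checks the
four sign–radius vertex matrices of the resulting head-cell sums.
[cite: KosPolandSimmonsduffin2014, §3.3 eq. (3.16), §4 eqs. (4.2)–(4.3)] [cite: HogervorstRychkov2013, §3 eqs. (3.6), (3.9)]
[cite: Hladik2017, Thm. 1 ((2) ⇒ (1))] -/
theorem pos0p_on_cell_Ico_of_corners (F : ScanFunctional) (D : Dims) {ℓ : ℕ} {a b : ℝ}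
    (ha : unitarityBound3D ℓ < a) (S : Finset (ℕ × ℕ))
    (hvert : ∀ z : Fin 3 → Bool, (signRadMatrix
      (fun i => headCellSumI ℓ a b S (fun q => boxLo0p F D q.2 (a + q.1) (b + q.1) i))
      (Matrix.of fun i k => headAbsSumI ℓ a b S (fun q => boxRad0p F D q.2 (a + q.1) (b + q.1) i k))
        z).PosSemidef)
    (htail : ∀ q : ℕ × ℕ, q ∉ S → InDescendantRange ℓ q.1 q.2 →
      ∀ E ∈ Icc (a + q.1) (b + q.1), (termMatrix0p F D E q.2).PosSemidef) :
    ∀ Δ ∈ Ico a b, Pos0p F.toFunctional D Δ ℓ := by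
  refine pos0p_on_cell_Ico F D ha S (fun i q => boxLo0p F D q.2 (a + q.1) (b + q.1) i)
    (fun i k q => boxRad0p F D q.2 (a + q.1) (b + q.1) i k) (fun q _ Δ hΔ i => ?_)
    (fun q _ Δ hΔ i k _ => ?_) hvert htail
  · rw [boxLo0p, termMatrix0p_apply_eq_twoWeightEval]
    exact (twoWeightEval_mem_Icc_corner F _ _ q.2 (E := Δ + (q.1 : ℝ))
      ⟨by linarith [hΔ.1], by linarith [hΔ.2]⟩ _).1
  · rw [boxRad0p, Matrix.of_apply, termMatrix0p_apply_eq_twoWeightEval]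
    have h := twoWeightEval_mem_Icc_corner F (cw0p F i k) (dw0p F i k) q.2 (E₁ := a + (q.1 : ℝ))
      (E₂ := b + (q.1 : ℝ)) (E := Δ + (q.1 : ℝ)) ⟨by linarith [hΔ.1], by linarith [hΔ.2]⟩
      (D.expo (lab0p i k))
    exact abs_le_max_of_mem h.1 h.2

/-- **`0⁻` cell rule with corner tables** (closed form `X, Y ≥ 0`, `Z² ≤ X Y` on the head-cell sums of the
corner numbers). [cite: KosPolandSimmonsduffin2014, §3.3 eq. (3.16), §4 eqs. (4.2)–(4.3)]
[cite: HogervorstRychkov2013, §3 eqs. (3.6), (3.9)] -/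
theorem pos0m_on_cell_Ico_of_corners (F : ScanFunctional) (D : Dims) {ℓ : ℕ} {a b : ℝ}
    (ha : unitarityBound3D ℓ < a) (S : Finset (ℕ × ℕ))
    (hX : 0 ≤ headCellSumI ℓ a b S (fun q => cornerBound₂ (cw0m F 0 0) (dw0m F 0 0) F.z F.zb q.2
      (a + q.1) (b + q.1) (D.expo (lab0m 0 0)) (D.expo (lab0m 0 0))))
    (hY : 0 ≤ headCellSumI ℓ a b S (fun q => cornerBound₂ (cw0m F 1 1) (dw0m F 1 1) F.z F.zb q.2
      (a + q.1) (b + q.1) (D.expo (lab0m 1 1)) (D.expo (lab0m 1 1))))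
    (hdet : headAbsSumI ℓ a b S (fun q =>
        max (-cornerBound₂ (cw0m F 0 1) (dw0m F 0 1) F.z F.zb q.2 (a + q.1) (b + q.1) (D.expo (lab0m 0 1))
            (D.expo (lab0m 0 1)))
          (-cornerBound₂ (-cw0m F 0 1) (-dw0m F 0 1) F.z F.zb q.2 (a + q.1) (b + q.1) (D.expo (lab0m 0 1))
            (D.expo (lab0m 0 1)))) ^ 2 ≤
      headCellSumI ℓ a b S (fun q => cornerBound₂ (cw0m F 0 0) (dw0m F 0 0) F.z F.zb q.2
          (a + q.1) (b + q.1) (D.expo (lab0m 0 0)) (D.expo (lab0m 0 0))) *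
        headCellSumI ℓ a b S (fun q => cornerBound₂ (cw0m F 1 1) (dw0m F 1 1) F.z F.zb q.2
          (a + q.1) (b + q.1) (D.expo (lab0m 1 1)) (D.expo (lab0m 1 1))))
    (htail : ∀ q : ℕ × ℕ, q ∉ S → InDescendantRange ℓ q.1 q.2 →
      ∀ E ∈ Icc (a + q.1) (b + q.1), (termMatrix0m F D E q.2).PosSemidef) :
    ∀ Δ ∈ Ico a b, Pos0m F.toFunctional D Δ ℓ := by
  refine pos0m_on_cell_Ico F D ha S
    (fun i q => cornerBound₂ (cw0m F i i) (dw0m F i i) F.z F.zb q.2 (a + q.1) (b + q.1)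
      (D.expo (lab0m i i)) (D.expo (lab0m i i)))
    (fun q => max (-cornerBound₂ (cw0m F 0 1) (dw0m F 0 1) F.z F.zb q.2 (a + q.1) (b + q.1)
        (D.expo (lab0m 0 1)) (D.expo (lab0m 0 1)))
      (-cornerBound₂ (-cw0m F 0 1) (-dw0m F 0 1) F.z F.zb q.2 (a + q.1) (b + q.1) (D.expo (lab0m 0 1))
        (D.expo (lab0m 0 1))))
    (fun q _ Δ hΔ i => ?_) (fun q _ Δ hΔ => ?_) hX hY hdet htail
  · rw [termMatrix0m_apply_eq_twoWeightEval]
    exact (twoWeightEval_mem_Icc_corner F _ _ q.2 (E := Δ + (q.1 : ℝ))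
      ⟨by linarith [hΔ.1], by linarith [hΔ.2]⟩ _).1
  · rw [termMatrix0m_apply_eq_twoWeightEval]
    have h := twoWeightEval_mem_Icc_corner F (cw0m F 0 1) (dw0m F 0 1) q.2 (E₁ := a + (q.1 : ℝ))
      (E₂ := b + (q.1 : ℝ)) (E := Δ + (q.1 : ℝ)) ⟨by linarith [hΔ.1], by linarith [hΔ.2]⟩
      (D.expo (lab0m 0 1))
    exact abs_le_max_of_mem h.1 h.2

/-- **Cell tails from (M)/(T), sector `0⁺`.** For a cell `[a, b]` strictly above the unitarity bound with
`ℓ + τ ≤ a`, a head set `S` containing every in-range `(n, j)` with `n < N₀`, and `a + N₀ ≥ E₀`: the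
termwise facts (M) on `E ∈ [E₀, E_T)`, `j + τ ≤ E` and (T) on `E ≥ E_T`, `j ≤ E` give every cell-tail
hypothesis. [cite: HogervorstRychkov2013, §3 eqs. (3.6), (3.9)] -/
theorem cellTail0p_of_termwise (F : ScanFunctional) (D : Dims) {ℓ : ℕ} {a b E₀ ET τ : ℝ}
    (ha : unitarityBound3D ℓ < a) (hτ : (ℓ : ℝ) + τ ≤ a) (N₀ : ℕ) (hN : E₀ ≤ a + N₀)
    (S : Finset (ℕ × ℕ)) (hS : ∀ q : ℕ × ℕ, InDescendantRange ℓ q.1 q.2 → q.1 < N₀ → q ∈ S)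
    (hM : ∀ (j : ℕ) (E : ℝ), E₀ ≤ E → E < ET → (j : ℝ) + τ ≤ E → (termMatrix0p F D E j).PosSemidef)
    (hT : ∀ E : ℝ, ET ≤ E → ∀ j : ℕ, (j : ℝ) ≤ E → (termMatrix0p F D E j).PosSemidef) :
    ∀ q : ℕ × ℕ, q ∉ S → InDescendantRange ℓ q.1 q.2 →
      ∀ E ∈ Icc (a + q.1) (b + q.1), (termMatrix0p F D E q.2).PosSemidef := by
  intro q hq hr E hE
  have hn : (N₀ : ℝ) ≤ (q.1 : ℝ) := by
    have : ¬ q.1 < N₀ := fun h => hq (hS q hr h)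
    exact_mod_cast not_lt.1 this
  have hE0 : E₀ ≤ E := by linarith [hE.1]
  have h1 : (q.2 : ℝ) ≤ (ℓ : ℝ) + (q.1 : ℝ) := by exact_mod_cast hr.2.1
  have hjE : (q.2 : ℝ) + τ ≤ E := by linarith [hE.1]
  have hjE' : (q.2 : ℝ) ≤ E := by linarith [hE.1, natCast_add_half_le_unitarityBound3D ℓ]
  by_cases hlt : E < ET
  · exact hM q.2 E hE0 hlt hjE
  · exact hT E (not_lt.1 hlt) q.2 hjE'

/-- **Cell tails from (M)/(T), sector `0⁻`.** [cite: HogervorstRychkov2013, §3 eqs. (3.6), (3.9)] -/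
theorem cellTail0m_of_termwise (F : ScanFunctional) (D : Dims) {ℓ : ℕ} {a b E₀ ET τ : ℝ}
    (ha : unitarityBound3D ℓ < a) (hτ : (ℓ : ℝ) + τ ≤ a) (N₀ : ℕ) (hN : E₀ ≤ a + N₀)
    (S : Finset (ℕ × ℕ)) (hS : ∀ q : ℕ × ℕ, InDescendantRange ℓ q.1 q.2 → q.1 < N₀ → q ∈ S)
    (hM : ∀ (j : ℕ) (E : ℝ), E₀ ≤ E → E < ET → (j : ℝ) + τ ≤ E → (termMatrix0m F D E j).PosSemidef)
    (hT : ∀ E : ℝ, ET ≤ E → ∀ j : ℕ, (j : ℝ) ≤ E → (termMatrix0m F D E j).PosSemidef) :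
    ∀ q : ℕ × ℕ, q ∉ S → InDescendantRange ℓ q.1 q.2 →
      ∀ E ∈ Icc (a + q.1) (b + q.1), (termMatrix0m F D E q.2).PosSemidef := by
  intro q hq hr E hE
  have hn : (N₀ : ℝ) ≤ (q.1 : ℝ) := by
    have : ¬ q.1 < N₀ := fun h => hq (hS q hr h)
    exact_mod_cast not_lt.1 this
  have hE0 : E₀ ≤ E := by linarith [hE.1]
  have h1 : (q.2 : ℝ) ≤ (ℓ : ℝ) + (q.1 : ℝ) := by exact_mod_cast hr.2.1
  have hjE : (q.2 : ℝ) + τ ≤ E := by linarith [hE.1]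
  have hjE' : (q.2 : ℝ) ≤ E := by linarith [hE.1, natCast_add_half_le_unitarityBound3D ℓ]
  by_cases hlt : E < ET
  · exact hM q.2 E hE0 hlt hjE
  · exact hT E (not_lt.1 hlt) q.2 hjE'

end Literature.MathematicalPhysics.QuantumFieldTheory.O2NeutralSectorsTail
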